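import Literature.Claims.NS.Otelbaev2013
import Summits.NavierStokesRegularity.NavierStokesRegularity.Theorems.SoloRefuteOtelbaev2013Model
import HarnessLib

/-!
# NS-claims map, C01: where the printed argument of Otelbaev (2013) stops being a proof

Kernel-checked refutations of two typed statements of the claim skeleton
`Literature.Claims.NS.Otelbaev2013` (Мат. журнал **13** (2013) no. 4, 5–104):
* `not_Theorem61 : ¬ Theorem61` — Theorem 6.1 (p. 29), the root `h₁` of `claim_of_steps`
  (LOCATOR; class: false lemma (countermodel));
* `not_Theorem62 : ¬ Theorem62` — Theorem 6.2 ((6.59), pp. 72–73), the statement §7 consumes;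
* `theorem62_of_theorem61_vacuous` — Step 2 holds vacuously after the kill.
Witness: the 53-dimensional family of `SoloRefuteOtelbaev2013Model` (the 2014 dxdy.ru construction,
bib `DxdyTopic80156`, `MontgomerySmith2014Otelbaev`), packaged as the typed `Setting` `cS n` with
constants `β = −1/2`, `C_β = 4`, `θ = −1`, `C_θ = 1`, `λ₂ = 50`, `(n, C_P) = (1, 1)`.
Axioms: `propext`, `Classical.choice`, `Quot.sound` only.
WHAT THIS IS NOT: not a claim about NS regularity or blow-up; not a claim about any author beyond
the typed locator.
-/

noncomputable section

open Real Finset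

-- The summit's canonical theorem namespace repeats the summit name (single-conjunct summit).
set_option linter.dupNamespace false

namespace Summit.NavierStokesRegularity.NavierStokesRegularity.Theorems.Otelbaev2013

variable (n : ℕ)

/-! ## The model as a typed `Setting` and the hypotheses (У.1)–(У.5) -/

open Literature.Claims.NS.Otelbaev2013

/-- The model as a typed `Setting`: the standard Hilbert basis of `ℝ⁵³`, eigenvalues `ev n`, and the
form `L n` packaged as a bilinear map. -/
def cS : Setting (Fin 53) H where
  basis := (EuclideanSpace.basisFun (Fin 53) ℝ).toHilbertBasis
  eig := ev n
  L := LinearMap.mk₂ ℝ (L n) (L_add_left n) (L_smul_left n) (L_add_right n) (L_smul_right n)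

/-- The packaged form is `L n`. -/
@[simp] theorem cS_L_apply (u v : H) : (cS n).L u v = L n u v := rfl

/-- The packaged eigenvalues are `ev n`. -/
@[simp] theorem cS_eig : (cS n).eig = ev n := rfl

/-- The packaged basis is the standard basis (not a simp lemma: coefficients are normalised by
`inner_cS_basis`). -/
theorem cS_basis (i : Fin 53) : (cS n).basis i = e i := by
  simp [cS]

/-- Coefficients against the packaged basis are coordinates. -/
@[simp] theorem inner_cS_basis (i : Fin 53) (u : H) : inner ℝ ((cS n).basis i) u = u i := by
  rw [cS_basis, EuclideanSpace.inner_single_left]; simp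

/-- `f(u) = u + L(u,u)` in the model. -/
theorem cS_nl (u : H) : (cS n).nl u = u + L n u u := rfl

/-- `A^s` in the typed sense is the diagonal action `Apow`. -/
theorem eq_Apow_of_isPow {s : ℝ} {u w : H} (h : (cS n).IsPow s u w) : w = Apow n s u := by
  ext i
  have hi := h i
  simpa using hi

/-- `Apow n s u` is `A^s u` in the typed sense. -/
theorem isPow_Apow (s : ℝ) (u : H) : (cS n).IsPow s u (Apow n s u) := by
  intro i; simp

/-- **(У.1)** for the model with `β = −1/2`, `C_β = 4` (uniformly in `n`). -/
theorem cS_Y1 (hn : 1 ≤ n) : (cS n).Y1 (-1 / 2) 4 := by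
  refine ⟨one_le_ev n hn, fun u v wu wv hu hv => ?_⟩
  rw [eq_Apow_of_isPow n hu, eq_Apow_of_isPow n hv, cS_L_apply]
  exact norm_L_le n hn u v

/-- **(У.2)** for the model. -/
theorem cS_Y2 : (cS n).Y2 := by
  rintro u ⟨lam, h⟩
  have h' : ∀ i : Fin 53, u i ≠ 0 → ev n i = lam := fun i hi => h i (by simpa using hi)
  rw [cS_L_apply, L_self_eq_zero_of_eigen n h', inner_zero_right]

/-- **(У.3)** for the model (`n ≥ 26`): `λ₁ = 1` with a 50-dimensional eigenspace, `λ₂ = 50`,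
finitely many eigenvalues. -/
theorem cS_Y3 (hn : 26 ≤ n) : (cS n).Y3 := by
  have hn1 : 1 ≤ n := le_trans (by norm_num) hn
  refine ⟨⟨⟨0, by norm_num⟩, ?_⟩, one_le_ev n hn1,
    ⟨50, by norm_num, by norm_num, ⟨i50, ev_i50 n⟩, fun i => ?_⟩,
    ⟨Fin.castLE (by norm_num), Fin.castLE_injective _, fun k => ?_⟩,
    fun R => (Set.finite_range _).subset Set.inter_subset_left⟩
  · rw [cS_eig]; exact ev_of_lt n (by norm_num)
  · by_cases h : ev n i = 1
    · exact Or.inl h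
    · exact Or.inr (ev_ge_fifty_of_ne_one n hn h)
  · rw [cS_eig]; exact ev_of_lt n (lt_of_lt_of_le k.isLt (by norm_num))

/-- Members of `G₁` have vanishing coordinates `51` and `52`. -/
theorem coords_eq_zero_of_mem_G1 (hn : 1 ≤ n) {w : H} (hw : w ∈ (cS n).G1) :
    w ia = 0 ∧ w ib = 0 := by
  have hw' : ∀ i : Fin 53, w i ≠ 0 → ev n i = 1 := fun i hi => hw i (by simpa using hi)
  constructor
  · by_contra h; exact ev_ia_ne_one n hn (hw' ia h)
  · by_contra h; exact ev_ib_ne_one n hn (hw' ib h)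

/-- **(У.4)** for the model: `L` vanishes when an argument lies in `G₁`, and `range L ⊥ G₁`. -/
theorem cS_Y4 (hn : 1 ≤ n) : (cS n).Y4 := by
  intro w hw u
  obtain ⟨ha, hb⟩ := coords_eq_zero_of_mem_G1 n hn hw
  have h1 : ∀ v : H, L n w v = 0 := fun v => L_eq_zero_of_left n ha v
  have h2 : ∀ v : H, L n v w = 0 := fun v => L_eq_zero_of_right n v hb
  refine ⟨?_, ?_, ?_, fun g => ?_, ?_, fun g => ?_⟩
  · rw [cS_L_apply, h1]
  · rw [cS_L_apply, h2]
  · simp only [Setting.Lsym, cS_L_apply, h1, h2, add_zero]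
  · simp only [Setting.Lsym, cS_L_apply, inner_add_left, inner_L_eq_zero n _ _ ha hb, add_zero]
  · simp only [Setting.Lsym, cS_L_apply, h1, h2, add_zero]
  · simp only [Setting.Lsym, cS_L_apply, h1, h2, add_zero, inner_zero_left]

/-- A typed projector onto `G₁` acts coordinatewise: it keeps the first 50 coordinates. -/
theorem proj_apply {P : H →ₗ[ℝ] H} (hP : (cS n).IsProjG1 P) (w : H) (i : Fin 53) :
    P w i = if ev n i = 1 then w i else 0 := by
  simpa using hP w i

/-- `P L = 0` for a typed projector onto `G₁`. -/
theorem proj_L (hn : 1 ≤ n) {P : H →ₗ[ℝ] H} (hP : (cS n).IsProjG1 P) (u v : H) :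
    P (L n u v) = 0 := by
  ext i
  rw [proj_apply n hP, PiLp.zero_apply]
  split_ifs with h
  · refine L_apply_of_ne n u v ?_ ?_
    · rintro rfl; exact ev_ia_ne_one n hn h
    · rintro rfl; exact ev_ib_ne_one n hn h
  · rfl

/-- `L_P(u,v) = 0` in the model, for every typed projector onto `G₁`. -/
theorem cS_LP_eq_zero (hn : 1 ≤ n) {P : H →ₗ[ℝ] H} (hP : (cS n).IsProjG1 P) (u v : H) :
    (cS n).LP P u v = 0 := by
  have hPa : ∀ w : H, P w ia = 0 := fun w => by
    rw [proj_apply n hP, if_neg (ev_ia_ne_one n hn)]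
  have hPb : ∀ w : H, P w ib = 0 := fun w => by
    rw [proj_apply n hP, if_neg (ev_ib_ne_one n hn)]
  simp only [Setting.LP, cS_L_apply, L_eq_zero_of_left n (hPa u), L_eq_zero_of_right n u (hPb v),
    proj_L n hn hP, add_zero, map_zero, sub_self]

/-- **(У.5)** for the model, with `n = 1`, `C_P = 1` (indeed `L_P(u,u) = 0`). -/
theorem cS_Y5 (hn : 1 ≤ n) : (cS n).Y5 1 1 := by
  refine ⟨zero_le_one, one_pos, fun P hP u => ?_⟩
  rw [cS_LP_eq_zero n hn hP, norm_zero]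
  positivity

/-- The weak estimate `‖A⁻¹ ů‖ ≤ 1` in the typed sense (`θ = −1`, `C_θ = 1`). -/
theorem cS_weakEstimate (hn : 1 ≤ n) : (cS n).WeakEstimate (-1) 1 (uo n) :=
  ⟨Apow n (-1) (uo n), isPow_Apow n (-1) (uo n), norm_Apow_neg_one_uo n hn⟩

/-! ## The kills -/

/-- Refutes `Literature.Claims.NS.Otelbaev2013.Theorem61` (Theorem 6.1, p. 29 — the root `h₁` of
`claim_of_steps`) [refuted-substantive; cell class: false lemma (countermodel)]: the printed
theorem asserts constants `C₁, l` depending ONLY on `(C_β, β, C_θ, θ)` ("the value of our theorem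
is precisely that `C₁` and `l` do not depend on the dimension of `Ĥ`", p. 62).  Witness: the
family `cS n` on `ℝ⁵³` (`n ≥ 26`) satisfies (У.1) with `β = −1/2`, `C_β = 4`, (У.2), (У.3), (У.4),
and `ů = −n(e₅₁ + e₅₂)` has `‖A⁻¹ ů‖ ≤ 1` (`θ = −1`), `f̊ = 0`, `‖ů‖ = n√2 → ∞`.  Repairs tried:
the per-space reading `Theorem61PerSpace` (constants chosen after `(Ĥ, A, L)`) is NOT hit by this
finite family (in a fixed finite-dimensional space (6.1) holds with dimension-dependent constants,
p. 62) but is hit by the `ℓ₂` version of the same construction (dxdy.ru topic 80156, post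
p817605, 2014-01-21; not formalised here); no repair keeping dimension-free constants survives,
since the witness satisfies every listed hypothesis with fixed constants.  Source of the
construction: bib `DxdyTopic80156`, `MontgomerySmith2014Otelbaev` (the passage (6.33) → (6.34),
p. 56, was withdrawn 2014-02-14). -/
theorem not_Theorem61 : ¬ Theorem61 := by
  intro hT
  obtain ⟨C₁, l, hC⟩ := hT (-1 / 2) 4 (-1) 1 (by norm_num) (by norm_num) (by norm_num)
  obtain ⟨n, hn, hviol⟩ := exists_violation C₁ l
  have hn1 : 1 ≤ n := le_trans (by norm_num) hn
  exact hviol (hC (Fin 53) H (cS n) (cS_Y1 n hn1) (cS_Y2 n) (cS_Y3 n hn) (cS_Y4 n hn1) (uo n)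
    (cS_weakEstimate n hn1))

/-- Refutes `Literature.Claims.NS.Otelbaev2013.Theorem62` (Theorem 6.2, (6.59) pp. 72–73, the
statement §7 consumes) [refuted-substantive; cell class: false lemma (countermodel)], by the same
family: it also satisfies (У.5) with `n = 1`, `C_P = 1` (indeed `L_P ≡ 0`, since a projector onto
`G₁` kills `e₅₁, e₅₂` and `range L`). -/
theorem not_Theorem62 : ¬ Theorem62 := by
  intro hT
  obtain ⟨C₂, m, hC⟩ := hT (-1 / 2) 4 (-1) 1 1 1 (by norm_num) (by norm_num) (by norm_num)
  obtain ⟨n, hn, hviol⟩ := exists_violation C₂ m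
  have hn1 : 1 ≤ n := le_trans (by norm_num) hn
  exact hviol (hC (Fin 53) H (cS n) (cS_Y1 n hn1) (cS_Y2 n) (cS_Y3 n hn) (cS_Y5 n hn1) (uo n)
    (cS_weakEstimate n hn1))

/-- Step 2 (`Theorem62_of_Theorem61 : Theorem61 → Theorem62`, pp. 71–73) holds VACUOUSLY once
Theorem 6.1 is refuted; recorded so the map can table Steps 2–4 as implications from a false
premise. -/
theorem theorem62_of_theorem61_vacuous : Theorem62_of_Theorem61 :=
  fun h => (not_Theorem61 h).elim

end Summit.NavierStokesRegularity.NavierStokesRegularity.Theorems.Otelbaev2013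

end
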